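import Summits.CriticalPhenomena.PercolationContinuityZ3.Theorems.PercBudgetLadderPinholeClosingPocketTwoPockets
import HarnessLib

/-!
# Pocket resampling for `PercBudgetLadder.PinholeClosing` (stmt-CriticalPhenomena-5249) — the liveness identity and the kill inequality

Continues `PercBudgetLadderPinholeClosingPocketTwoPockets.lean` (objects `bEv`, `exactEv`, `IsTightPocket`, `hybrid`, `revival`,
`livenessMass`, `qKill`).  Results (all at `p = p_c(ℤ³)`, window `(n, m)`):
* §1 measurability / integrability of the liveness mass `D`;
* §2 **the liveness identity** `∫ D dμc = μc(exactEv k n m)` for `n < m` (`integral_livenessMass_eq`): block disintegration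
  (`Theorems.stub_blockDisintegration`) per pocket + locality + existence/uniqueness of the tight pocket on `{budget = k+1}`;
* §3 **the kill inequality** `qKill · μc(exactEv k n (ln)) ≤ ∫_{bEv k n (2ln)} D dμc` (`kill_inequality`): per pocket, a fresh
  exterior closes the `≤ 5` exterior edges at a door with probability `≥ (1-p_c)^5` (`Theorems.stub_doorKill`) — the door being
  located by the pocket, no entropy is paid; the identity converts `∫ D` into `μc(exact)`;
* the def-free registered form `Theorems.stub_pocketKill`.
-/

noncomputable section

namespace Summit.CriticalPhenomena.PercolationContinuityZ3.Theorems

open MeasureTheory Finset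
open Literature.Probability.Percolation Literature.Probability.LatticeModels
open Summit.CriticalPhenomena.PercolationContinuityZ3.Theses
open Summit.CriticalPhenomena.PercolationContinuityZ3.Theorems.PinholeClosing.Negative
open scoped Classical

namespace PocketResampling

/-! ## §1 Measurability of the liveness mass -/

/-- C1a: the revival probability is measurable. -/
theorem measurable_revival (k n m : ℕ) (A : Finset (Site 3)) : Measurable (revival k n m A) :=
  measurable_hybridProb A (measurableSet_exactEv k n m)

/-- C1b: each term of the liveness mass is measurable. -/
theorem measurable_term (k n m : ℕ) (A : Finset (Site 3)) :
    Measurable ({ξ : BondConfig (Site 3) | IsTightPocket k n m ξ A}.indicator (revival k n m A)) :=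
  (measurable_revival k n m A).indicator (measurableSet_isTightPocket k n m A)

/-- **C1**: the liveness mass is measurable. -/
theorem measurable_livenessMass (k n m : ℕ) : Measurable (livenessMass k n m) := by
  unfold livenessMass
  exact Finset.measurable_sum _ fun A _ => measurable_term k n m A

/-! ## §2 The liveness identity `E[D] = P(budget = k+1)` -/

/-- Bounded measurable real functions are `μc`-integrable. -/
theorem integrable_of_abs_le {f : BondConfig (Site 3) → ℝ} (hf : Measurable f) {C : ℝ}
    (hC : ∀ ω, |f ω| ≤ C) : Integrable f μc :=
  Integrable.of_bound hf.aestronglyMeasurable C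
    (Filter.Eventually.of_forall fun ω => by rw [Real.norm_eq_abs]; exact hC ω)

/-- Each term of the liveness mass is integrable. -/
theorem integrable_term (k n m : ℕ) (A : Finset (Site 3)) :
    Integrable ({ξ : BondConfig (Site 3) | IsTightPocket k n m ξ A}.indicator (revival k n m A)) μc :=
  integrable_of_abs_le (measurable_term k n m A) (abs_term_le_one k n m A)

/-- The term of the liveness mass at `A` as the tightness indicator times the revival probability. -/
theorem term_eq_mul (k n m : ℕ) (A : Finset (Site 3)) (ω : BondConfig (Site 3)) :
    {ξ : BondConfig (Site 3) | IsTightPocket k n m ξ A}.indicator (revival k n m A) ω =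
      {ξ : BondConfig (Site 3) | IsTightPocket k n m ξ A}.indicator (fun _ => (1 : ℝ)) ω *
        revival k n m A ω := by
  by_cases h : ω ∈ {ξ : BondConfig (Site 3) | IsTightPocket k n m ξ A}
  · rw [Set.indicator_of_mem h, Set.indicator_of_mem h, one_mul]
  · rw [Set.indicator_of_notMem h, Set.indicator_of_notMem h, zero_mul]

/-- The tightness indicator reads `ω` only through `ω ∩ edgesTouching A`. -/
theorem tightInd_inter (k n m : ℕ) (A : Finset (Site 3)) (ω : BondConfig (Site 3)) :
    {ξ : BondConfig (Site 3) | IsTightPocket k n m ξ A}.indicator (fun _ => (1 : ℝ)) ω =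
      {ξ : BondConfig (Site 3) | IsTightPocket k n m ξ A}.indicator (fun _ => (1 : ℝ))
        (ω ∩ ↑(edgesTouching (zdGraph 3) A)) := by
  by_cases h : IsTightPocket k n m ω A
  · have h' : IsTightPocket k n m (ω ∩ ↑(edgesTouching (zdGraph 3) A)) A := isTightPocket_inter.2 h
    rw [Set.indicator_of_mem (show ω ∈ {ξ | IsTightPocket k n m ξ A} from h),
      Set.indicator_of_mem (show ω ∩ ↑(edgesTouching (zdGraph 3) A) ∈ {ξ | IsTightPocket k n m ξ A} from h')]
  · have h' : ¬ IsTightPocket k n m (ω ∩ ↑(edgesTouching (zdGraph 3) A)) A := fun h' => h (isTightPocket_inter.1 h')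
    rw [Set.indicator_of_notMem (show ω ∉ {ξ | IsTightPocket k n m ξ A} from h),
      Set.indicator_of_notMem (show ω ∩ ↑(edgesTouching (zdGraph 3) A) ∉ {ξ | IsTightPocket k n m ξ A} from h')]

/-- The term of the liveness mass reads `ω` only through `ω ∩ edgesTouching A`. -/
theorem term_inter (k n m : ℕ) (A : Finset (Site 3)) (ω : BondConfig (Site 3)) :
    {ξ : BondConfig (Site 3) | IsTightPocket k n m ξ A}.indicator (revival k n m A) ω =
      {ξ : BondConfig (Site 3) | IsTightPocket k n m ξ A}.indicator (revival k n m A)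
        (ω ∩ ↑(edgesTouching (zdGraph 3) A)) := by
  rw [term_eq_mul, term_eq_mul, revival_inter, ← tightInd_inter]

/-- The tightness indicator has absolute value at most `1`. -/
theorem abs_tightInd_le_one (k n m : ℕ) (A : Finset (Site 3)) (ω : BondConfig (Site 3)) :
    |{ξ : BondConfig (Site 3) | IsTightPocket k n m ξ A}.indicator (fun _ => (1 : ℝ)) ω| ≤ 1 := by
  by_cases h : ω ∈ {ξ : BondConfig (Site 3) | IsTightPocket k n m ξ A}
  · rw [Set.indicator_of_mem h]; simp
  · rw [Set.indicator_of_notMem h]; simp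

/-- Indicator of an intersection as a product of indicators (constant-one version). -/
theorem indicator_inter_one_mul (s t : Set (BondConfig (Site 3))) (ω : BondConfig (Site 3)) :
    (s ∩ t).indicator (fun _ => (1 : ℝ)) ω = s.indicator (fun _ => (1 : ℝ)) ω * t.indicator (fun _ => (1 : ℝ)) ω := by
  by_cases hs : ω ∈ s <;> by_cases ht : ω ∈ t <;> simp [hs, ht]

/-- C3a: per-pocket identity `∫ 𝟙_{tight A} · revival A = ∫ 𝟙_{tight A ∩ exact}` (block disintegration with
`φ = 𝟙_{tight A}`, `F = exact`). -/
theorem integral_term_eq (k n m : ℕ) (A : Finset (Site 3)) :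
    ∫ ω, {ξ : BondConfig (Site 3) | IsTightPocket k n m ξ A}.indicator (revival k n m A) ω ∂μc =
      ∫ ω, ({ξ : BondConfig (Site 3) | IsTightPocket k n m ξ A} ∩ exactEv k n m).indicator
        (fun _ => (1 : ℝ)) ω ∂μc := by
  have h := integral_mul_indicator_eq_integral_mul_hybridProb A
    (φ := {ξ : BondConfig (Site 3) | IsTightPocket k n m ξ A}.indicator fun _ => (1 : ℝ))
    (F := exactEv k n m) (measurable_const.indicator (measurableSet_isTightPocket k n m A))
    ⟨1, abs_tightInd_le_one k n m A⟩ (tightInd_inter k n m A) (measurableSet_exactEv k n m)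
  calc ∫ ω, {ξ : BondConfig (Site 3) | IsTightPocket k n m ξ A}.indicator (revival k n m A) ω ∂μc
      = ∫ ω, {ξ : BondConfig (Site 3) | IsTightPocket k n m ξ A}.indicator (fun _ => (1 : ℝ)) ω *
          revival k n m A ω ∂μc := by
        simp_rw [term_eq_mul]
    _ = ∫ ω, {ξ : BondConfig (Site 3) | IsTightPocket k n m ξ A}.indicator (fun _ => (1 : ℝ)) ω *
          (exactEv k n m).indicator (fun _ => (1 : ℝ)) ω ∂μc := h.symm
    _ = _ := by
        simp_rw [indicator_inter_one_mul]

/-- C3b: `∫ D = Σ_A ∫ term_A`. -/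
theorem integral_livenessMass (k n m : ℕ) :
    ∫ ω, livenessMass k n m ω ∂μc =
      ∑ A ∈ (box 3 m).powerset,
        ∫ ω, {ξ : BondConfig (Site 3) | IsTightPocket k n m ξ A}.indicator (revival k n m A) ω ∂μc := by
  unfold livenessMass
  exact integral_finsetSum _ fun A _ => integrable_term k n m A

/-- C3c: on a lattice configuration (`n < m`) the sum over `A ⊆ box m` of the indicators of
`{tight A} ∩ exact` is the indicator of `exact` (existence: stub 2; uniqueness: `tightPocket_unique`). -/
theorem sum_indicator_tight_inter_exact {k n m : ℕ} (hnm : n < m) {ω : BondConfig (Site 3)}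
    (hω : ω ⊆ (zdGraph 3).edgeSet) :
    ∑ A ∈ (box 3 m).powerset, ({ξ : BondConfig (Site 3) | IsTightPocket k n m ξ A} ∩ exactEv k n m).indicator
        (fun _ => (1 : ℝ)) ω = (exactEv k n m).indicator (fun _ => (1 : ℝ)) ω := by
  by_cases hex : ω ∈ exactEv k n m
  · obtain ⟨A₀, hA₀⟩ := exists_isTightPocket (k := k) hnm hω hex.1
    rw [Set.indicator_of_mem hex, Finset.sum_eq_single_of_mem A₀ (mem_powerset_of_isTightPocket hA₀)]
    · exact Set.indicator_of_mem
        (show ω ∈ {ξ : BondConfig (Site 3) | IsTightPocket k n m ξ A₀} ∩ exactEv k n m from ⟨hA₀, hex⟩) _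
    · intro A _ hne
      refine Set.indicator_of_notMem ?_ _
      rintro ⟨hA, -⟩
      exact hne (tightPocket_unique hω hex hA hA₀)
  · refine (Finset.sum_eq_zero fun A _ => ?_).trans (Set.indicator_of_notMem hex _).symm
    exact Set.indicator_of_notMem (fun h => hex h.2) _

/-- **C3**: the liveness identity `E[D] = P(budget = k+1)` (`n < m`). -/
theorem integral_livenessMass_eq {k n m : ℕ} (hnm : n < m) :
    ∫ ω, livenessMass k n m ω ∂μc = μc.real (exactEv k n m) := by
  rw [integral_livenessMass]
  simp_rw [integral_term_eq]
  rw [← integral_finsetSum _ fun A _ => integrable_of_abs_le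
    (measurable_const.indicator ((measurableSet_isTightPocket k n m A).inter (measurableSet_exactEv k n m)))
    (C := 1) (fun ω => ?_)]
  · have hae : ∀ᵐ ω ∂μc, ∑ A ∈ (box 3 m).powerset,
        ({ξ : BondConfig (Site 3) | IsTightPocket k n m ξ A} ∩ exactEv k n m).indicator (fun _ => (1 : ℝ)) ω =
          (exactEv k n m).indicator (fun _ => (1 : ℝ)) ω := by
      filter_upwards [ae_subset] with ω hω using sum_indicator_tight_inter_exact hnm hω
    rw [integral_congr_ae hae, integral_indicator_const (1 : ℝ) (measurableSet_exactEv k n m), smul_eq_mul,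
      mul_one]
  · by_cases h : ω ∈ {ξ : BondConfig (Site 3) | IsTightPocket k n m ξ A} ∩ exactEv k n m
    · rw [Set.indicator_of_mem h]; simp
    · rw [Set.indicator_of_notMem h]; simp

/-! ## §3 The kill inequality -/

/-- C4a: per-pocket kill `q · ∫ term_A ≤ ∫ term_A · 𝟙_{bEv k n (2ln)}` (block disintegration with
`φ = term_A`, `F = bEv k n (2ln)`, then the door kill on the tight event). -/
theorem qKill_mul_integral_term_le {k n l : ℕ} (hl : 2 ≤ l) (hn : 1 ≤ n) (A : Finset (Site 3)) :
    qKill * ∫ ω, {ξ : BondConfig (Site 3) | IsTightPocket k n (l * n) ξ A}.indicator (revival k n (l * n) A) ω ∂μc ≤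
      ∫ ω, {ξ : BondConfig (Site 3) | IsTightPocket k n (l * n) ξ A}.indicator (revival k n (l * n) A) ω *
        (bEv k n (2 * l * n)).indicator (fun _ => (1 : ℝ)) ω ∂μc := by
  rw [integral_mul_indicator_eq_integral_mul_hybridProb A (measurable_term k n (l * n) A)
    ⟨1, abs_term_le_one k n (l * n) A⟩ (term_inter k n (l * n) A) (measurableSet_bEv k n (2 * l * n)),
    ← integral_const_mul]
  refine integral_mono_ae ((integrable_term k n (l * n) A).const_mul qKill) ?_ ?_
  · refine integrable_of_abs_le ((measurable_term k n (l * n) A).mul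
      (measurable_hybridProb A (measurableSet_bEv k n (2 * l * n)))) (C := 1) fun ω => ?_
    rw [abs_mul]
    exact mul_le_one₀ (abs_term_le_one k n (l * n) A ω) (abs_nonneg _)
      ((abs_of_nonneg measureReal_nonneg).trans_le measureReal_le_one)
  · filter_upwards [ae_subset] with ω hω
    by_cases hA : IsTightPocket k n (l * n) ω A
    · have hq := qKill_le_hybridProb (k := k) hl hn hω hA.1 hA.2.1
      rw [mul_comm]
      exact mul_le_mul_of_nonneg_left hq (term_nonneg k n (l * n) A ω)
    · rw [Set.indicator_of_notMem (show ω ∉ {ξ : BondConfig (Site 3) | IsTightPocket k n (l * n) ξ A} from hA),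
        mul_zero, zero_mul]

/-- C4b: the restricted integral of `D` as a sum of per-pocket integrals against `𝟙_F`. -/
theorem setIntegral_livenessMass (k n m : ℕ) {F : Set (BondConfig (Site 3))} (hF : MeasurableSet F) :
    ∫ ω in F, livenessMass k n m ω ∂μc =
      ∑ A ∈ (box 3 m).powerset,
        ∫ ω, {ξ : BondConfig (Site 3) | IsTightPocket k n m ξ A}.indicator (revival k n m A) ω *
          F.indicator (fun _ => (1 : ℝ)) ω ∂μc := by
  rw [← integral_indicator hF]
  have hpt : ∀ ω, F.indicator (livenessMass k n m) ω =
      ∑ A ∈ (box 3 m).powerset,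
        {ξ : BondConfig (Site 3) | IsTightPocket k n m ξ A}.indicator (revival k n m A) ω *
          F.indicator (fun _ => (1 : ℝ)) ω := by
    intro ω
    by_cases h : ω ∈ F
    · rw [Set.indicator_of_mem h, Set.indicator_of_mem h]
      unfold livenessMass
      simp
    · rw [Set.indicator_of_notMem h, Set.indicator_of_notMem h]
      simp
  simp_rw [hpt]
  refine integral_finsetSum _ fun A _ => ?_
  refine integrable_of_abs_le ((measurable_term k n m A).mul (measurable_const.indicator hF)) (C := 1) fun ω => ?_
  rw [abs_mul]
  refine mul_le_one₀ (abs_term_le_one k n m A ω) (abs_nonneg _) ?_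
  by_cases h : ω ∈ F
  · rw [Set.indicator_of_mem h]; simp
  · rw [Set.indicator_of_notMem h]; simp

/-- `n < l n` for `l ≥ 2`, `n ≥ 1`. -/
theorem lt_mul_of_two_le {n l : ℕ} (hl : 2 ≤ l) (hn : 1 ≤ n) : n < l * n := by
  nlinarith

/-- **C4**: the kill inequality `q · P(exact) ≤ ∫_{bEv k n (2ln)} D`. -/
theorem kill_inequality {k n l : ℕ} (hl : 2 ≤ l) (hn : 1 ≤ n) :
    qKill * μc.real (exactEv k n (l * n)) ≤ ∫ ω in bEv k n (2 * l * n), livenessMass k n (l * n) ω ∂μc := by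
  rw [← integral_livenessMass_eq (lt_mul_of_two_le hl hn), integral_livenessMass,
    setIntegral_livenessMass k n (l * n) (measurableSet_bEv k n (2 * l * n)), Finset.mul_sum]
  exact Finset.sum_le_sum fun A _ => qKill_mul_integral_term_le hl hn A


end PocketResampling

/-- **Registered stub `stub_pocketKill` (def-free form of `PocketResampling.kill_inequality`):**
`(1-p_c)^5 · P(budget(n, ln) = k+1) ≤ ∫_{budget(n, 2ln) ≤ k} D`. -/
theorem stub_pocketKill :
    ∀ (k n l : ℕ), 2 ≤ l → 1 ≤ n →
      (1 - ((criticalProbI 3 : unitInterval) : ℝ)) ^ 5 *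
          (bondPercolation (zdGraph 3) (criticalProbI 3)).real
            ({ζ : BondConfig (Site 3) | ∃ S : Finset (Sym2 (Site 3)), S.card ≤ k + 1 ∧ ¬ ∃ x ∈ box 3 n,
            ∃ y ∈ innerBoundary (zdGraph 3) (box 3 (l * n)),
              (ζ \ (↑S : Set (Sym2 (Site 3)))) ∈ openConnIn (↑(box 3 (l * n)) : Set (Site 3)) x y} \
            {ζ : BondConfig (Site 3) | ∃ S : Finset (Sym2 (Site 3)), S.card ≤ k ∧ ¬ ∃ x ∈ box 3 n,
            ∃ y ∈ innerBoundary (zdGraph 3) (box 3 (l * n)),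
              (ζ \ (↑S : Set (Sym2 (Site 3)))) ∈ openConnIn (↑(box 3 (l * n)) : Set (Site 3)) x y}) ≤
        ∫ ω in {ζ : BondConfig (Site 3) | ∃ S : Finset (Sym2 (Site 3)), S.card ≤ k ∧ ¬ ∃ x ∈ box 3 n,
            ∃ y ∈ innerBoundary (zdGraph 3) (box 3 (2 * l * n)),
              (ζ \ (↑S : Set (Sym2 (Site 3)))) ∈ openConnIn (↑(box 3 (2 * l * n)) : Set (Site 3)) x y},
          (∑ A ∈ (box 3 (l * n)).powerset,
          {ξ : BondConfig (Site 3) |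
          (box 3 n ⊆ A ∧ A ⊆ box 3 (l * n) \ innerBoundary (zdGraph 3) (box 3 (l * n))) ∧
          ((edgeBoundary (zdGraph 3) A).filter (· ∈ ξ)).card ≤ k + 1 ∧
          ∀ A' : Finset (Site 3), (box 3 n ⊆ A' ∧ A' ⊆ box 3 (l * n) \ innerBoundary (zdGraph 3) (box 3 (l * n))) →
          A' ⊂ A → k + 2 ≤ ((edgeBoundary (zdGraph 3) A').filter (· ∈ ξ)).card}.indicator
          (fun ξ : BondConfig (Site 3) => (bondPercolation (zdGraph 3) (criticalProbI 3)).real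
          {ω' : BondConfig (Site 3) |
          (ξ ∩ ↑(edgesTouching (zdGraph 3) A)) ∪ (ω' \ ↑(edgesTouching (zdGraph 3) A)) ∈
          {ζ : BondConfig (Site 3) | ∃ S : Finset (Sym2 (Site 3)), S.card ≤ k + 1 ∧ ¬ ∃ x ∈ box 3 n,
          ∃ y ∈ innerBoundary (zdGraph 3) (box 3 (l * n)),
          (ζ \ (↑S : Set (Sym2 (Site 3)))) ∈ openConnIn (↑(box 3 (l * n)) : Set (Site 3)) x y} \
          {ζ : BondConfig (Site 3) | ∃ S : Finset (Sym2 (Site 3)), S.card ≤ k ∧ ¬ ∃ x ∈ box 3 n,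
          ∃ y ∈ innerBoundary (zdGraph 3) (box 3 (l * n)),
          (ζ \ (↑S : Set (Sym2 (Site 3)))) ∈ openConnIn (↑(box 3 (l * n)) : Set (Site 3)) x y}})
          ω) ∂(bondPercolation (zdGraph 3) (criticalProbI 3)) :=
  fun _k _n _l hl hn => PocketResampling.kill_inequality hl hn

end Summit.CriticalPhenomena.PercolationContinuityZ3.Theorems
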